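import Literature.MathematicalPhysics.QuantumFieldTheory.Balaban1983to89.B9Eq325RLipschitzSqrtTower
import Literature.MathematicalPhysics.QuantumFieldTheory.Balaban1983to89.B9Eq364GreenLipschitzFormTower
import Literature.MathematicalPhysics.QuantumFieldTheory.Balaban1983to89.B9Thm311FlatLettersTower
import Literature.MathematicalPhysics.QuantumFieldTheory.Balaban1983to89.B9Eq365QGGQLowerVariationalSharp
import Literature.MathematicalPhysics.QuantumFieldTheory.Balaban1983to89.B9Eq319QprimeTowerLipschitzL2
import Literature.MathematicalPhysics.QuantumFieldTheory.Balaban1983to89.B9Eq384RemainderLetters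

/-!
# `Balaban1983to89.B9Eq325RLipschitzSqrtTowerDiagonal` — T. Bałaban, *Propagators for lattice gauge theories in a background field*, Commun. Math.
# Phys. **99** (1985) 389–434 [Balaban1985BackgroundPropagators] p. 403 «R(U), P(U) = I − R(U) … satisfy the same bounds» with (3.24)–(3.25) p. 394,
# (3.16) p. 393, (3.35) p. 396, Thm 3.11 p. 416: **THE `k`-LEVEL `R`-LETTER ON PRINT's DIAGONAL WITH EVERY LETTER BUT `θ_Q` DISCHARGED, AND `θ_Q`
# DISCHARGED BY ne9-leaf-02's TOWER `Q̃′`-LETTER** — at `ηL^{n+1} = 1`, `c₀(L^{n+1})^d = c₁`, fine bonds `U(b) ∈ U1`, `‖U(b) − 1‖ ≤ αη`, `hRS`: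
# `‖R_{n+1}(U)f − R_{n+1}(1)f‖ ≤ (δ_A∕(s♯ − δ_A) + δ_A∕s♯)·‖f‖`, `s♯ = √κ♯`, `κ♯ = (12d(6∕5)^{d−1} + a′)⁻²`, `δ_A = θ_G(1 + θ_Q) + (2 + 2∕a′)θ_Q`,
# `θ_G = 2δ_Dγ_U⁻¹(√γ_U)⁻¹ + a′θ_Q(2 + θ_Q)γ_U⁻²`, `γ_U = 1∕(2 + 2∕a′) − (δ_D + δ_D² + a′θ_Q(2 + θ_Q))`, `δ_D = √d·2M_φM_φ′·α` — EVERY constant a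
# function of `(d, a′, M_φM_φ′, α, θ_Q)`: NO `η`, NO `L`, NO volume `m`, NO number of levels `n`; the route-G END for the `hR` slot of the NE9 owner's
# `B9Thm311SmallFieldCoercivityTowerDiagonal.strong_coercive_tower_diagonal`

statement-level skeleton of published theorems with citation tags; proofs where landed; nothing here is a claim about the Yang–Mills mass gap

PDF held: `paper:balaban1985-cmp99-background-propagators` (journal page = PDF page + 388), pp. 393–396, 402–403, 416 — through the verbatim quotations
of the supplier files (`B9Eq325RLipschitzSqrt`, `B9Eq325ProjFormula`, `B9Eq364GreenLipschitzForm`, `B9Thm311SitePrimeFormCoercive`,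
`B9Eq365QGGQLowerVariationalSharp`, `B9Eq319QprimeTowerLipschitzL2`).

CITATION HEADER (lean-in-tree rule 2026-08-18).  Audit cell `pub-balaban`, sub-cell `t4`, NE9 crux team (2): LEAF PROVER 04
(`b2b-balaban-t4-ne9-formalise-leaf-04` gen 75), INTENT-4.  Route R2′ STEP B7′ sub-step S3 in the tower currency = the NE9 owner g85's «ROUTE G ONE
STOREY UP» (journal l.47319): the owner's `B9Thm311SmallFieldCoercivityTowerDiagonal.strong_coercive_tower_diagonal` states the `k`-level strong
small-field coercivity on print's diagonal MODULO ONE displayed letter `hR : ‖(R_k(U) − R_k(1))y‖ ≤ C_R·α·‖y‖`; THIS FILE produces the `k`-level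
`R`-letter with closed constants — κ₀ from ne9-leaf-01's sharp floor (`B9Eq365QGGQLowerVariationalSharp`) carried by the owner's
`B9Eq325ProjFormulaTower.re_inner_QGGQk_one_eq_oneStep`; `γ_f`, `g` from ne9-leaf-03's flat site coercivity carried by the owner's
`B9Thm311FlatLettersTower.flat_site_strong_coercive_tower_diagonal`; `γ_U`, `θ_G` from this lineage's `B9Eq364GreenLipschitzFormTower`; `δ_D` from
`B9Eq373DerivativeRemainderL2.norm_covDerivL2K_sub_le` + `B9Eq384RemainderLetters.norm_adTransportW_sub_le`; `M_Q`, `θ_Q` from ne9-leaf-02's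
`B9Eq319QprimeTowerLipschitzL2` §4; assembled by this lineage's `B9Eq325RLipschitzSqrtTower.norm_RofUk_sub_RofUk_one_le_sqrt` (ne9-leaf-01's `κ^{−1∕2}`
device `B9Eq325RLipschitzSqrt` §1 BY NAME).

THE PRINT (verbatim, as quoted by the suppliers).  p. 403 l. 27–28: *«These results imply that the operators R(U), P(U) = I − R(U) extend analytically
to the domain (3.37) and satisfy the same bounds»*; (3.35) p. 396: the η-scaled small-field class; (3.16) p. 393: the `k`-th-step normalisation
(`η = L^{−k}`, unit coarse lattice); Thm 3.11 p. 416: *«… uniformly in k»* ∕ «γ₀ independent of k».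

WHAT IS PROVED (sorry-free; 0 `def`; [folklore] composition of LANDED letters BY NAME + real arithmetic on displayed closed forms; nothing of [B9] asserted).
* §1 (letters on the diagonal) `eta_pos_of_diagonal`, **`norm_covDerivL2K_sub_flat_le_diagonal`** (`‖D_Uλ − D_1λ‖ ≤ √d·2M_φM_φ′·α·‖λ‖` — η-FREE:
  the `‖η⁻¹‖` of the derivative eats the `η` of the scaled window), `norm_QtildeTower_one_le_diagonal` (`‖Q̃′_{n+1}(1)v‖ ≤ ‖v‖`, leaf-02),
  `coercive_laplacePrimeAk_one_diagonal` (`(1∕(2+2∕a′))‖λ‖² ≤ re⟨λ, Δ′_{a′,k}(1)λ⟩`), `norm_GpOfUk_one_le_diagonal` (`‖G′_k(1)y‖ ≤ (2+2∕a′)‖y‖`),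
  `qggqk_coercive_sharp_one_diagonal` (`κ♯‖ψ‖² ≤ re⟨ψ, K′_k(1)ψ⟩`).
* §2 **`norm_RofUk_sub_RofUk_one_le_diagonal_of_thetaQ`** — with ONE displayed letter `θ_Q` (`‖Q̃′_k(U)v − Q̃′_k(1)v‖ ≤ θ_Q‖v‖`) and the closed letters
  `δ_D, γ_U, θ_G` bound by definitional equalities, in the window `0 < γ_U`, `δ_D ≤ 1∕(2+2∕a′)`, `δ_A < √κ♯`: the displayed bound above.
* §3 **`norm_RofUk_sub_RofUk_one_le_diagonal`** — `θ_Q` DISCHARGED by ne9-leaf-02's `norm_QtildeTower_sub_flat_le`: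
  `θ_Q := Π_{j≤n}(1 + 2M_φM_φ′ε_j)^{d(L−1)} − 1` for level averages `Ū^j(b) ∈ U1`, `‖Ū^j(b) − 1‖ ≤ ε_j` (print's running small-field axioms, displayed);
  every other letter as in §2.  The number of levels enters ONLY through the displayed profile product (k-free under a geometric profile: leaf-02's
  `sqrt_sum_norm_sq_QprimeTowerW_sub_flat_le_geometric`).
MODEL ∕ DECLARED READINGS.  (M1) as `B9Eq324DeltaPrimeATower` ∕ `B9Eq325RLipschitzSqrtTower`.  (M2) «diagonal» = (3.16): `ηL^{n+1} = 1`, `c₁ = c₀L^{(n+1)d}`;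
the fine-bond window `‖U(b) − 1‖ ≤ αη` and the level-average windows `ε_j` are DISPLAYED (print's (3.35) ∕ [I] (1.11)–(1.14) running axioms — the
gauge question, Lemma 3.1 ∕ (3.37), is NOT touched); `hRS` displayed.  (M3) the bound is the `κ^{−1∕2}`-road SHAPE `δ_A(1∕(s♯ − δ_A) + 1∕s♯)`; its α-linear
reading on a half-window and the numerical size of the window are NOT asserted here (cf. ne9-leaf-01's one-step `B9Eq325RLipschitzClosedSqrt` §2–§3).
HONEST SCOPE.  [folklore] assembly; ONE route sub-step (S3 at `k` levels) closed at the point MODULO the displayed small-field windows; «NE9 ⇐ the named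
binders»; NE9 NOT PRINTED ∕ NOT PROVED; NOT summit progress (cell pub-balaban: row NE9 WALLED ON A MODEL; spine PROVED 0∕9; rung (B)+1 on a finite T⁴ —
NOT infinite volume, NOT mass gap, NOT BetaPertH, NOT Clay).  NEW file; nothing modified.  Net new unproved facts: 0.
-/

noncomputable section

open scoped InnerProductSpace ComplexConjugate BigOperators

namespace Literature.MathematicalPhysics.QuantumFieldTheory.Balaban1983to89.B9Eq325RLipschitzSqrtTowerDiagonal

open B4Sect5Torus (TSite)
open B9SectCLatticeCarrier (Bond)
open B9Eq311L2Pairing (WL2)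
open B9Eq319QprimeTorus (fineP)
open B7Prop1Explicit (U1)
open B11Eq103H1Complex (SiteL2K greenK covDerivL2K)
open B9Eq310HessianOperator (adTransportW)
open B9Eq315QTower (towerP UlevOf)
open B9Eq326OperatorTower (QprimeTowerW RofUk)
open B9Eq3119DeltaPiCarrier (laplacePrimeA GpOfU)
open B9Thm311DeltaPrimeA (laplacePrimeA_one_pos)
open B5Eq172HodgePositivity (adTransportW_one hRS_one)
open B9Eq316TowerFlatIsOneStep (towerP_eq_fineP_pow)
open B9Eq324DeltaPrimeATower (laplacePrimeAk GpOfUk laplacePrimeAk_one_pos)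
open B9Eq325ProjFormulaTower (re_inner_QGGQk_one_eq_oneStep)
open B9Thm311FlatLettersTower (flat_site_strong_coercive_tower_diagonal)
open B9Eq365QGGQLowerVariationalSharp (qggq_coercive_sharp_one_diagonal)
open B9Eq319QprimeTowerLipschitzL2 (norm_QtildeTower_sub_flat_le norm_QtildeTower_one_le)
open B9Eq373DerivativeRemainderL2 (norm_covDerivL2K_sub_le)
open B9Eq384RemainderLetters (norm_adTransportW_sub_le)
open B9Eq3126GreenLetters (norm_greenK_le)
open B9Eq364GreenLipschitzFormTower (coercive_laplacePrimeAk_of_letters laplacePrimeAk_pos_of_letters norm_GpOfUk_sub_GpOfUk_le)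
open B9Eq325RLipschitzSqrtTower (norm_RofUk_sub_RofUk_one_le_sqrt)

variable {d : ℕ} (L : ℕ) [NeZero L] (m : Fin d → ℕ) [∀ i, NeZero (m i)] (n : ℕ)
  {𝔸 : Type*} [NormedRing 𝔸] [NormedAlgebra ℂ 𝔸] [CompleteSpace 𝔸] [NormOneClass 𝔸]
  {W : Type*} [NormedAddCommGroup W] [InnerProductSpace ℂ W] [FiniteDimensional ℂ W] (φ : W ≃ₗ[ℂ] 𝔸) {Mφ Mφ' : ℝ} (hMφ : 0 ≤ Mφ) (hMφ' : 0 ≤ Mφ')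
  (hφ : ∀ w, ‖φ w‖ ≤ Mφ * ‖w‖) (hφ' : ∀ X, ‖φ.symm X‖ ≤ Mφ' * ‖X‖)
  (c₀ : ℝ) [Fact (0 < c₀)] (η : ℝ) (c₁ : ℝ) [Fact (0 < c₁)] {a' : ℝ} (ha' : 0 < a')
  (hηL : η * (L : ℝ) ^ (n + 1) = 1) (hw : c₀ * ((L : ℝ) ^ (n + 1)) ^ d = c₁)
  (U : Bond d (towerP L m (n + 1)) → 𝔸ˣ)
  (hRS : ∀ (b : Bond d (towerP L m (n + 1))) (v u : W), ⟪adTransportW φ U b v, u⟫_ℂ = ⟪v, adTransportW φ (fun b => (U b)⁻¹) b u⟫_ℂ)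
  {α : ℝ} (hα : 0 ≤ α) (hUb : ∀ b, U b ∈ U1 𝔸) (hUε : ∀ b, ‖(U b : 𝔸) - 1‖ ≤ α * η)

/-! ## §1 The letters on the diagonal -/

omit [NeZero L] in
include hηL in
/-- On the diagonal `ηL^{n+1} = 1` the fine spacing is positive. [cite: Balaban1985BackgroundPropagators, (3.16) p.393] -/
theorem eta_pos_of_diagonal : 0 < η := by
  have hLr : (0 : ℝ) ≤ (L : ℝ) ^ (n + 1) := by positivity
  rcases lt_or_ge 0 η with h | h
  · exact h
  · have : η * (L : ℝ) ^ (n + 1) ≤ 0 := mul_nonpos_of_nonpos_of_nonneg h hLr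
    linarith

omit [NeZero L] [∀ i, NeZero (m i)] [CompleteSpace 𝔸] [FiniteDimensional ℂ W] [Fact (0 < c₁)] in
include hMφ hMφ' hφ hφ' hηL hα hUb hUε in
/-- **THE DERIVATIVE DEFECT IS η-FREE IN PRINT's SCALED WINDOW**: `‖D_Uλ − D_1λ‖ ≤ √d·2M_φM_φ′·α·‖λ‖` — the transporters are `2M_φM_φ′·αη`-close to the
identity (`B9Eq384RemainderLetters.norm_adTransportW_sub_le`), the derivative carries `‖η⁻¹‖` (`B9Eq373DerivativeRemainderL2.norm_covDerivL2K_sub_le`),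
and `‖η⁻¹‖·η = 1`. [cite: Balaban1985BackgroundPropagators, (3.35) p.396, (3.70)–(3.71) pp.404–405] -/
theorem norm_covDerivL2K_sub_flat_le_diagonal (lam : SiteL2K ℂ d (towerP L m (n + 1)) c₀ W) :
    ‖covDerivL2K ℂ c₀ ((η : ℂ))⁻¹ (adTransportW φ U) lam -
        covDerivL2K ℂ c₀ ((η : ℂ))⁻¹ (adTransportW φ (fun _ : Bond d (towerP L m (n + 1)) => (1 : 𝔸ˣ))) lam‖ ≤
      (Real.sqrt d * (2 * Mφ * Mφ') * α) * ‖lam‖ := by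
  have hη0 : 0 < η := eta_pos_of_diagonal L n η hηL
  have hεR : 0 ≤ 2 * Mφ * Mφ' * (α * η) := by positivity
  have hR : ∀ (b : Bond d (towerP L m (n + 1))) (w : W), ‖adTransportW φ U b w - w‖ ≤ 2 * Mφ * Mφ' * (α * η) * ‖w‖ :=
    fun b w => norm_adTransportW_sub_le φ hφ hφ' hMφ' U b (hUb b) (hUε b) w
  have hR₁ : ∀ (b : Bond d (towerP L m (n + 1))) (w : W), adTransportW φ (fun _ : Bond d (towerP L m (n + 1)) => (1 : 𝔸ˣ)) b w = w :=
    fun b w => by rw [adTransportW_one]; rfl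
  have h := norm_covDerivL2K_sub_le (((η : ℂ))⁻¹) hεR hR hR₁ lam
  have hηinv : ‖((η : ℂ))⁻¹‖ * η = 1 := by
    rw [norm_inv, Complex.norm_real, Real.norm_eq_abs, abs_of_pos hη0, inv_mul_cancel₀ hη0.ne']
  calc _ ≤ ‖((η : ℂ))⁻¹‖ * (2 * Mφ * Mφ' * (α * η)) * Real.sqrt d * ‖lam‖ := h
    _ = (Real.sqrt d * (2 * Mφ * Mφ') * α) * (‖((η : ℂ))⁻¹‖ * η) * ‖lam‖ := by ring
    _ = (Real.sqrt d * (2 * Mφ * Mφ') * α) * ‖lam‖ := by rw [hηinv, mul_one]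

omit [NormOneClass 𝔸] [FiniteDimensional ℂ W] in
include hw in
/-- **`‖Q̃′_{n+1}(1)v‖ ≤ ‖v‖` on the diagonal** (ne9-leaf-02's `norm_QtildeTower_one_le` with `c₁∕(c₀L^{(n+1)d}) = 1`). [cite: Balaban1985BackgroundPropagators, (3.19) p.393, (3.16) p.393] -/
theorem norm_QtildeTower_one_le_diagonal (v : SiteL2K ℂ d (towerP L m (n + 1)) c₀ W) :
    ‖((WL2.linearEquiv ℂ ℂ (fun _ : TSite d m => c₁)).symm.toLinearMap ∘ₗ
        QprimeTowerW L m n φ (fun _ : Bond d (towerP L m (n + 1)) => (1 : 𝔸ˣ)) (c₀ := c₀)) v‖ ≤ ‖v‖ := by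
  have hc₁ : 0 < c₁ := Fact.out
  have h := norm_QtildeTower_one_le L m n φ (c₀ := c₀) c₁ v
  rw [hw, div_self hc₁.ne', Real.sqrt_one, one_mul] at h
  exact h

omit [NormOneClass 𝔸] in
include ha' hηL hw in
/-- **`(1∕(2+2∕a′))·‖λ‖² ≤ re⟨λ, Δ′_{a′,k}(1)λ⟩` on the diagonal** (the owner's `flat_site_strong_coercive_tower_diagonal`, gradient row dropped).
[cite: Balaban1985BackgroundPropagators, Thm 3.11 p.416, (3.24) p.394] -/
theorem coercive_laplacePrimeAk_one_diagonal (lam : SiteL2K ℂ d (towerP L m (n + 1)) c₀ W) :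
    (1 / (2 + 2 / a')) * ‖lam‖ ^ 2 ≤
      RCLike.re ⟪lam, laplacePrimeAk L m n φ η (fun _ : Bond d (towerP L m (n + 1)) => (1 : 𝔸ˣ)) a' (c₁ := c₁) lam⟫_ℂ := by
  have h := flat_site_strong_coercive_tower_diagonal L m n φ c₀ η c₁ ha' hηL hw lam
  have h0 : 0 ≤ (1 / (2 + 2 / a')) *
      ‖covDerivL2K ℂ c₀ ((η : ℂ))⁻¹ (adTransportW φ (fun _ : Bond d (towerP L m (n + 1)) => (1 : 𝔸ˣ))) lam‖ ^ 2 := by positivity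
  nlinarith [h, h0]

omit [NormOneClass 𝔸] in
include ha' hηL hw in
/-- **`‖G′_k(1)y‖ ≤ (2 + 2∕a′)·‖y‖` on the diagonal** (`B9Eq3126GreenLetters.norm_greenK_le` at the flat coercivity) — the `g` letter, a function of `a′` ONLY.
[cite: Balaban1985BackgroundPropagators, Thm 3.11 p.416, (3.25) p.394, (3.64) p.402] -/
theorem norm_GpOfUk_one_le_diagonal (hη : η ≠ 0) (y : SiteL2K ℂ d (towerP L m (n + 1)) c₀ W) :
    ‖GpOfUk L m n φ η (fun _ : Bond d (towerP L m (n + 1)) => (1 : 𝔸ˣ)) a' (c₁ := c₁) (laplacePrimeAk_one_pos L m n φ η a' hη ha') y‖ ≤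
      (2 + 2 / a') * ‖y‖ := by
  have h : ‖GpOfUk L m n φ η (fun _ : Bond d (towerP L m (n + 1)) => (1 : 𝔸ˣ)) a' (c₁ := c₁) (laplacePrimeAk_one_pos L m n φ η a' hη ha') y‖ ≤
      (1 / (2 + 2 / a'))⁻¹ * ‖y‖ := by
    unfold GpOfUk
    exact norm_greenK_le (by positivity) (fun x => coercive_laplacePrimeAk_one_diagonal L m n φ c₀ η c₁ ha' hηL hw x) _ y
  rw [one_div, inv_inv] at h
  exact h

omit [NormOneClass 𝔸] in
include hηL hw in
/-- **`κ♯·‖ψ‖² ≤ re⟨ψ, Q̃′_kG′_k(1)²Q̃′_k†ψ⟩` on the diagonal, `κ♯ = (12d(6∕5)^{d−1} + a′)⁻²`** — ne9-leaf-01's `qggq_coercive_sharp_one_diagonal` AT BLOCK SIZE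
`L^{n+1}` (a floor valid for every block size `≥ 1`) carried to the `k`-level third operator by the owner's `re_inner_QGGQk_one_eq_oneStep`: the `κ₀` letter,
a function of `(d, a′)` ONLY for every `L` and every number of levels. [cite: Balaban1985BackgroundPropagators, Thm 3.11 p.416, (3.25) p.394; Balaban1984PropagatorsII, (2.77) p.236] -/
theorem qggqk_coercive_sharp_one_diagonal (hη : η ≠ 0) (ψ : SiteL2K ℂ d m c₁ W) :
    1 / (12 * (d : ℝ) * (6 / 5) ^ (d - 1) + a') ^ 2 * ‖ψ‖ ^ 2 ≤ RCLike.re ⟪ψ,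
      (((WL2.linearEquiv ℂ ℂ (fun _ : TSite d m => c₁)).symm.toLinearMap ∘ₗ
          QprimeTowerW L m n φ (fun _ : Bond d (towerP L m (n + 1)) => (1 : 𝔸ˣ)) (c₀ := c₀)) ∘ₗ
        GpOfUk L m n φ η (fun _ : Bond d (towerP L m (n + 1)) => (1 : 𝔸ˣ)) a' (c₁ := c₁) (laplacePrimeAk_one_pos L m n φ η a' hη ha') ∘ₗ
        GpOfUk L m n φ η (fun _ : Bond d (towerP L m (n + 1)) => (1 : 𝔸ˣ)) a' (c₁ := c₁) (laplacePrimeAk_one_pos L m n φ η a' hη ha') ∘ₗ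
        LinearMap.adjoint ((WL2.linearEquiv ℂ ℂ (fun _ : TSite d m => c₁)).symm.toLinearMap ∘ₗ
          QprimeTowerW L m n φ (fun _ : Bond d (towerP L m (n + 1)) => (1 : 𝔸ˣ)) (c₀ := c₀))) ψ⟫_ℂ := by
  haveI : NeZero (L ^ (n + 1)) := ⟨pow_ne_zero _ (NeZero.ne L)⟩
  have hcast : ((L ^ (n + 1) : ℕ) : ℝ) = (L : ℝ) ^ (n + 1) := by push_cast; ring
  rw [re_inner_QGGQk_one_eq_oneStep L m n φ c₀ η c₁ a' (towerP_eq_fineP_pow L m (n + 1)) (laplacePrimeAk_one_pos L m n φ η a' hη ha')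
    (laplacePrimeA_one_pos (L ^ (n + 1)) m φ η a' hη ha') ψ]
  exact qggq_coercive_sharp_one_diagonal (L ^ (n + 1)) m φ c₀ η c₁ hη (by rw [hcast]; exact hηL) (by rw [hcast]; exact hw) ha' ψ

/-! ## §2 The `k`-level `R`-letter on the diagonal, modulo the ONE displayed letter `θ_Q` -/

include hMφ hMφ' hφ hφ' ha' hηL hw hRS hα hUb hUε in
/-- **THE `k`-LEVEL `R`-LETTER ON PRINT's DIAGONAL MODULO `θ_Q`**: at `ηL^{n+1} = 1`, `c₀(L^{n+1})^d = c₁`, fine bonds `U(b) ∈ U1` with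
`‖U(b) − 1‖ ≤ αη`, `hRS`, and ONE displayed letter `‖Q̃′_k(U)v − Q̃′_k(1)v‖ ≤ θ_Q‖v‖`; with the CLOSED letters `δ_D = √d·2M_φM_φ′·α`,
`γ_U = 1∕(2+2∕a′) − (δ_D + δ_D² + a′θ_Q(2 + θ_Q))`, `θ_G = 2δ_D·γ_U⁻¹(√γ_U)⁻¹ + |a′|θ_Q(2 + θ_Q)·γ_U⁻²` (definitional equalities), in the window
`0 < γ_U`, `δ_D ≤ 1∕(2+2∕a′)`, `δ_A := θ_G(1 + θ_Q) + (2 + 2∕a′)θ_Q < √κ♯`, `κ♯ = (12d(6∕5)^{d−1} + a′)⁻²`: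
**`‖R_k(U)f − R_k(1)f‖ ≤ (δ_A∕(√κ♯ − δ_A) + δ_A∕√κ♯)·‖f‖`** — `B9Eq325RLipschitzSqrtTower.norm_RofUk_sub_RofUk_one_le_sqrt` with §1's letters and
`B9Eq364GreenLipschitzFormTower` (`γ_U`, positivity, `θ_G`).  NO `η`, `L`, `m`, `n` in any constant. [cite: Balaban1985BackgroundPropagators, p.403, (3.25) p.394, (3.35) p.396, Thm 3.11 p.416] -/
theorem norm_RofUk_sub_RofUk_one_le_diagonal_of_thetaQ {θQ δD γU θG : ℝ} (hθQ : 0 ≤ θQ)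
    (hdQ : ∀ v : SiteL2K ℂ d (towerP L m (n + 1)) c₀ W,
      ‖((WL2.linearEquiv ℂ ℂ (fun _ : TSite d m => c₁)).symm.toLinearMap ∘ₗ QprimeTowerW L m n φ U (c₀ := c₀)) v -
        ((WL2.linearEquiv ℂ ℂ (fun _ : TSite d m => c₁)).symm.toLinearMap ∘ₗ
          QprimeTowerW L m n φ (fun _ : Bond d (towerP L m (n + 1)) => (1 : 𝔸ˣ)) (c₀ := c₀)) v‖ ≤ θQ * ‖v‖)
    (hδDdef : δD = Real.sqrt d * (2 * Mφ * Mφ') * α)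
    (hγUdef : γU = 1 / (2 + 2 / a') - (δD + δD ^ 2 + a' * θQ * (2 * 1 + θQ)))
    (hθGdef : θG = 2 * δD * (γU⁻¹ * (Real.sqrt γU)⁻¹) + (|a'| * θQ * ((1 + θQ) + 1)) * γU⁻¹ ^ 2)
    (hγU : 0 < γU) (hDγ : δD ≤ 1 / (2 + 2 / a'))
    (hwin : θG * (1 + θQ) + (2 + 2 / a') * θQ < Real.sqrt (1 / (12 * (d : ℝ) * (6 / 5) ^ (d - 1) + a') ^ 2))
    (f : SiteL2K ℂ d (towerP L m (n + 1)) c₀ W) :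
    ‖RofUk L m n φ η U (c₀ := c₀) f - RofUk L m n φ η (fun _ : Bond d (towerP L m (n + 1)) => (1 : 𝔸ˣ)) (c₀ := c₀) f‖ ≤
      ((θG * (1 + θQ) + (2 + 2 / a') * θQ) / (Real.sqrt (1 / (12 * (d : ℝ) * (6 / 5) ^ (d - 1) + a') ^ 2) - (θG * (1 + θQ) + (2 + 2 / a') * θQ)) +
        (θG * (1 + θQ) + (2 + 2 / a') * θQ) / Real.sqrt (1 / (12 * (d : ℝ) * (6 / 5) ^ (d - 1) + a') ^ 2)) * ‖f‖ := by
  have hη0 : 0 < η := eta_pos_of_diagonal L n η hηL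
  have hη : η ≠ 0 := hη0.ne'
  have hδD0 : 0 ≤ δD := by rw [hδDdef]; positivity
  -- §1 letters
  have hD : ∀ l : SiteL2K ℂ d (towerP L m (n + 1)) c₀ W, ‖covDerivL2K ℂ c₀ ((η : ℂ))⁻¹ (adTransportW φ U) l -
      covDerivL2K ℂ c₀ ((η : ℂ))⁻¹ (adTransportW φ (fun _ : Bond d (towerP L m (n + 1)) => (1 : 𝔸ˣ))) l‖ ≤ δD * ‖l‖ := fun l => by
    rw [hδDdef]; exact norm_covDerivL2K_sub_flat_le_diagonal L m n φ hMφ hMφ' hφ hφ' c₀ η hηL U hα hUb hUε l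
  have hD' : ∀ l : SiteL2K ℂ d (towerP L m (n + 1)) c₀ W,
      ‖covDerivL2K ℂ c₀ ((η : ℂ))⁻¹ (adTransportW φ (fun _ : Bond d (towerP L m (n + 1)) => (1 : 𝔸ˣ))) l -
        covDerivL2K ℂ c₀ ((η : ℂ))⁻¹ (adTransportW φ U) l‖ ≤ δD * ‖l‖ := fun l => by rw [norm_sub_rev]; exact hD l
  have hQ1 : ∀ v : SiteL2K ℂ d (towerP L m (n + 1)) c₀ W, ‖((WL2.linearEquiv ℂ ℂ (fun _ : TSite d m => c₁)).symm.toLinearMap ∘ₗ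
      QprimeTowerW L m n φ (fun _ : Bond d (towerP L m (n + 1)) => (1 : 𝔸ˣ)) (c₀ := c₀)) v‖ ≤ 1 * ‖v‖ := fun v => by
    rw [one_mul]; exact norm_QtildeTower_one_le_diagonal L m n φ c₀ c₁ hw v
  have hQU : ∀ v : SiteL2K ℂ d (towerP L m (n + 1)) c₀ W,
      ‖((WL2.linearEquiv ℂ ℂ (fun _ : TSite d m => c₁)).symm.toLinearMap ∘ₗ QprimeTowerW L m n φ U (c₀ := c₀)) v‖ ≤ (1 + θQ) * ‖v‖ := by
    intro v
    have h1 := hQ1 v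
    have h2 := hdQ v
    have h3 := norm_le_norm_add_norm_sub' (((WL2.linearEquiv ℂ ℂ (fun _ : TSite d m => c₁)).symm.toLinearMap ∘ₗ QprimeTowerW L m n φ U (c₀ := c₀)) v)
      (((WL2.linearEquiv ℂ ℂ (fun _ : TSite d m => c₁)).symm.toLinearMap ∘ₗ
        QprimeTowerW L m n φ (fun _ : Bond d (towerP L m (n + 1)) => (1 : 𝔸ˣ)) (c₀ := c₀)) v)
    linarith
  have hdQ' : ∀ v : SiteL2K ℂ d (towerP L m (n + 1)) c₀ W,
      ‖((WL2.linearEquiv ℂ ℂ (fun _ : TSite d m => c₁)).symm.toLinearMap ∘ₗ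
          QprimeTowerW L m n φ (fun _ : Bond d (towerP L m (n + 1)) => (1 : 𝔸ˣ)) (c₀ := c₀)) v -
        ((WL2.linearEquiv ℂ ℂ (fun _ : TSite d m => c₁)).symm.toLinearMap ∘ₗ QprimeTowerW L m n φ U (c₀ := c₀)) v‖ ≤ θQ * ‖v‖ :=
    fun v => by rw [norm_sub_rev]; exact hdQ v
  have hflat : ∀ l : SiteL2K ℂ d (towerP L m (n + 1)) c₀ W,
      (1 / (2 + 2 / a')) * (‖covDerivL2K ℂ c₀ ((η : ℂ))⁻¹ (adTransportW φ (fun _ : Bond d (towerP L m (n + 1)) => (1 : 𝔸ˣ))) l‖ ^ 2 + ‖l‖ ^ 2) ≤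
        RCLike.re ⟪l, laplacePrimeAk L m n φ η (fun _ : Bond d (towerP L m (n + 1)) => (1 : 𝔸ˣ)) a' (c₁ := c₁) l⟫_ℂ :=
    fun l => flat_site_strong_coercive_tower_diagonal L m n φ c₀ η c₁ ha' hηL hw l
  -- coercivity and positivity of `Δ′_{a′,k}(U)`
  have hcoU : ∀ l : SiteL2K ℂ d (towerP L m (n + 1)) c₀ W, γU * ‖l‖ ^ 2 ≤ RCLike.re ⟪l, laplacePrimeAk L m n φ η U a' (c₁ := c₁) l⟫_ℂ := by
    intro l
    have h := coercive_laplacePrimeAk_of_letters L m n φ c₀ η U c₁ a' hRS ha'.le hδD0 hθQ hD hdQ hQ1 hDγ hflat l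
    rw [hγUdef]; exact h
  have hposU : ∀ x : SiteL2K ℂ d (towerP L m (n + 1)) c₀ W, x ≠ 0 → 0 < RCLike.re ⟪x, laplacePrimeAk L m n φ η U a' (c₁ := c₁) x⟫_ℂ := by
    intro x hx
    have h := hcoU x
    have hx2 : 0 < ‖x‖ ^ 2 := by positivity
    nlinarith
  have hco1 : ∀ l : SiteL2K ℂ d (towerP L m (n + 1)) c₀ W, γU * ‖l‖ ^ 2 ≤
      RCLike.re ⟪l, laplacePrimeAk L m n φ η (fun _ : Bond d (towerP L m (n + 1)) => (1 : 𝔸ˣ)) a' (c₁ := c₁) l⟫_ℂ := by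
    intro l
    have h := coercive_laplacePrimeAk_one_diagonal L m n φ c₀ η c₁ ha' hηL hw l
    have hle : γU ≤ 1 / (2 + 2 / a') := by
      rw [hγUdef]
      have : 0 ≤ δD + δD ^ 2 + a' * θQ * (2 * 1 + θQ) := by positivity
      linarith
    exact (mul_le_mul_of_nonneg_right hle (sq_nonneg _)).trans h
  -- the `θ_G` letter
  have hG : ∀ y : SiteL2K ℂ d (towerP L m (n + 1)) c₀ W, ‖GpOfUk L m n φ η U a' (c₁ := c₁) hposU y -
      GpOfUk L m n φ η (fun _ : Bond d (towerP L m (n + 1)) => (1 : 𝔸ˣ)) a' (c₁ := c₁) (laplacePrimeAk_one_pos L m n φ η a' hη ha') y‖ ≤ θG * ‖y‖ := by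
    intro y
    have h := norm_GpOfUk_sub_GpOfUk_le L m n φ c₀ η U (fun _ : Bond d (towerP L m (n + 1)) => (1 : 𝔸ˣ)) c₁ a' hRS (hRS_one φ) hposU
      (laplacePrimeAk_one_pos L m n φ η a' hη ha') ha'.le hγU hδD0 (by positivity : (0:ℝ) ≤ 1 + θQ) zero_le_one hθQ hcoU hco1 hD' hQU hQ1 hdQ' y
    rw [hθGdef]; exact h
  -- assemble on the `κ^{−1∕2}` road
  have hθG0 : 0 ≤ θG := by rw [hθGdef]; positivity
  exact norm_RofUk_sub_RofUk_one_le_sqrt L m n φ c₀ η U c₁ a' hη ha' hRS hposU (by positivity) hθG0 (by positivity) hθQ (by positivity)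
    (fun ψ => qggqk_coercive_sharp_one_diagonal L m n φ c₀ η c₁ ha' hηL hw hη ψ) hG hQU hdQ
    (fun y => norm_GpOfUk_one_le_diagonal L m n φ c₀ η c₁ ha' hηL hw hη y) hwin f

/-! ## §3 `θ_Q` discharged by ne9-leaf-02's tower `Q̃′`-letter: the `k`-level `R`-letter with every letter a closed form -/

include hMφ hMφ' hφ hφ' ha' hηL hw hRS hα hUb hUε in
/-- **THE `k`-LEVEL `R`-LETTER ON PRINT's DIAGONAL, EVERY LETTER CLOSED** — as §2 with `θ_Q := Π_{j≤n}(1 + 2M_φM_φ′ε_j)^{d(L−1)} − 1` for the level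
averages `Ū^j` (`B9Eq315QTower.UlevOf`) in `U1` with `‖Ū^j(b) − 1‖ ≤ ε_j` (print's running small-field axioms, displayed): ne9-leaf-02's
`B9Eq319QprimeTowerLipschitzL2.norm_QtildeTower_sub_flat_le` with `√(c₁∕(c₀L^{(n+1)d})) = 1`.  The constants depend on `(d, a′, M_φM_φ′, α)` and on
the displayed profile product only (k-free under a geometric profile); NO `η`, NO volume. [cite: Balaban1985BackgroundPropagators, p.403, (3.25) p.394, (3.35)–(3.37) p.396, Thm 3.11 p.416] -/
theorem norm_RofUk_sub_RofUk_one_le_diagonal (εU : ℕ → ℝ) (hεU : ∀ j, 0 ≤ εU j)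
    (hLε : ∀ (j : ℕ) (b : Bond d (towerP L m (j + 1))), ‖(UlevOf L m (n + 1) U j b : 𝔸) - 1‖ ≤ εU j)
    (hLb : ∀ (j : ℕ) (b : Bond d (towerP L m (j + 1))), UlevOf L m (n + 1) U j b ∈ U1 𝔸)
    {θQ δD γU θG : ℝ}
    (hθQdef : θQ = (∏ j ∈ Finset.range (n + 1), (1 + 2 * Mφ * Mφ' * εU j) ^ (d * (L - 1))) - 1)
    (hδDdef : δD = Real.sqrt d * (2 * Mφ * Mφ') * α)
    (hγUdef : γU = 1 / (2 + 2 / a') - (δD + δD ^ 2 + a' * θQ * (2 * 1 + θQ)))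
    (hθGdef : θG = 2 * δD * (γU⁻¹ * (Real.sqrt γU)⁻¹) + (|a'| * θQ * ((1 + θQ) + 1)) * γU⁻¹ ^ 2)
    (hγU : 0 < γU) (hDγ : δD ≤ 1 / (2 + 2 / a'))
    (hwin : θG * (1 + θQ) + (2 + 2 / a') * θQ < Real.sqrt (1 / (12 * (d : ℝ) * (6 / 5) ^ (d - 1) + a') ^ 2))
    (f : SiteL2K ℂ d (towerP L m (n + 1)) c₀ W) :
    ‖RofUk L m n φ η U (c₀ := c₀) f - RofUk L m n φ η (fun _ : Bond d (towerP L m (n + 1)) => (1 : 𝔸ˣ)) (c₀ := c₀) f‖ ≤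
      ((θG * (1 + θQ) + (2 + 2 / a') * θQ) / (Real.sqrt (1 / (12 * (d : ℝ) * (6 / 5) ^ (d - 1) + a') ^ 2) - (θG * (1 + θQ) + (2 + 2 / a') * θQ)) +
        (θG * (1 + θQ) + (2 + 2 / a') * θQ) / Real.sqrt (1 / (12 * (d : ℝ) * (6 / 5) ^ (d - 1) + a') ^ 2)) * ‖f‖ := by
  have hc₁ : 0 < c₁ := Fact.out
  have hθQ0 : 0 ≤ θQ := by
    rw [hθQdef]
    exact sub_nonneg.2 (Finset.one_le_prod (s := Finset.range (n + 1)) fun j _ => one_le_pow₀ (by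
      have h0 : 0 ≤ 2 * Mφ * Mφ' * εU j := by have := hεU j; positivity
      linarith))
  have hdQ : ∀ v : SiteL2K ℂ d (towerP L m (n + 1)) c₀ W,
      ‖((WL2.linearEquiv ℂ ℂ (fun _ : TSite d m => c₁)).symm.toLinearMap ∘ₗ QprimeTowerW L m n φ U (c₀ := c₀)) v -
        ((WL2.linearEquiv ℂ ℂ (fun _ : TSite d m => c₁)).symm.toLinearMap ∘ₗ
          QprimeTowerW L m n φ (fun _ : Bond d (towerP L m (n + 1)) => (1 : 𝔸ˣ)) (c₀ := c₀)) v‖ ≤ θQ * ‖v‖ := by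
    intro v
    have h := norm_QtildeTower_sub_flat_le L m n φ hMφ hMφ' hφ hφ' (c₀ := c₀) c₁ U εU hεU hLε hLb v
    rw [hw, div_self hc₁.ne', Real.sqrt_one, mul_one] at h
    rw [hθQdef]; exact h
  exact norm_RofUk_sub_RofUk_one_le_diagonal_of_thetaQ L m n φ hMφ hMφ' hφ hφ' c₀ η c₁ ha' hηL hw U hRS hα hUb hUε hθQ0 hdQ hδDdef hγUdef hθGdef
    hγU hDγ hwin f

end Literature.MathematicalPhysics.QuantumFieldTheory.Balaban1983to89.B9Eq325RLipschitzSqrtTowerDiagonal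

end
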